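import Summits.BirchSwinnertonDyer.Rank1Residual.X11b.FrameIdealRigidity
import Summits.BirchSwinnertonDyer.Rank1Residual.X11b.BDPRouteHsiehFrame
import Literature.NumberTheory.EllipticCurves.RankinSelbergGenusTwist
import Literature.NumberTheory.EllipticCurves.BDPBranchPAdicLFunction
import HarnessLib

/-!
# Route `SchneiderFreeAdditiveX3` (K1 door) / its wing: BRANCH-vs-FLAT RIGIDITY — a Castella–Hsieh `χ_ε`-BRANCH frame of
# the good member `f̃` and a ♭-frame of `f = f̃ ⊗ ε` at the same `(ι, 𝔮, κ, γ)` differ by the CONSTANT `ι⁻¹(e)` times a UNIT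
# of `𝓞_{ℂ_p}⟦T⟧` — the MATCH node of the LZZ/♭ road closed with NO avatar-at-`p` input

Cell `bsd-schneider-ideate`, seat `bsd-schneider-door-c5` (prover, generation 20; assembly layer).  PARTITION: board row
B6 ∩ X3 ∩ sst-twist, `r = 1`, (G-ord, `e = 2`) half, of `Rank1Residual.partition`; types-the-object-of nothing new; closes none
of B6's cells.  bears_on: K1-door r3 `GordTwoBranchIMC` (19177) and K1-wing r3 `GordTwoBranchCoIMCField` (20365) — the node
«MATCH» of FINDING-door-c5-g19 §2b.

THE POINT.  Generation 19 reduced the matching of a Castella–Hsieh branch frame `L` of `(f̃, χ_ε, e, Ω_K, Ω_p)`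
(`IsBranchBDPLFunction ι 𝔮 κ γ f̃ χ_ε e Ω_K Ω_p L`; value at `φ`:
`ι⁻¹(Γ(n)Γ(n+1)·e·φ(𝔮)⁻²·L(f̃/K, χ_ε φ, 1)/(π^{2n+1}Ω_K^{4n}))·Ω_p^{4n}`) with a ♭-frame `Q` of `f = f̃ ⊗ ε`
(`R1.IsBDPLFunctionInt p ι 𝔮 κ γ f Ω_K′ Ω_p′ Q`) to ONE displayed multiplier identity `hU` interpolating `e·φ(𝔮)⁻²`
(`…BranchFrameMatchOfMultiplier`, p635091), whose expected proof was the local shape of the `p`-adic avatar at `𝔮 ∣ p`.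
THIS FILE REMOVES THAT NODE ALTOGETHER: x11b3's ideal rigidity (`R1.exists_unit_mul_eq_of_values`, `FrameIdealRigidity`:
two series in `𝓞_{ℂ_p}⟦T⟧` whose values along the points `x^j − 1`, `x` a principal unit, differ by `b^j` differ by a UNIT)
applies to the pair `(C(c)·Q, L)` DIRECTLY — along the powers `φ_j = φ₀^{p^a j}` of the interpolation character
(`exists_interpolationCharacter`) the two prescribed values differ by

  `ι⁻¹(e) · ι⁻¹(φ₀(𝔮))^{−2 p^a j} · β^{m p^a j}`,  `β = ι⁻¹((Ω_K′/Ω_K)⁴)·(Ω_p/Ω_p′)⁴`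

(the twist identity `L(f̃/K, χ_ε φ, 1) = L(f/K, φ, 1)` — (M1), `rankinSelbergValueHecke_genusTwist_eq`, p633239; the Euler-type
factor of `f` is `1` since `a_p(f) = 0`, `p ∣ N`; `φ₀^n(𝔮) = φ₀(𝔮)^n`; period rescaling `frameValue_rescale`), i.e. by the
CONSTANT `ι⁻¹(e)` times `b^j` with `b = ι⁻¹(φ₀(𝔮)⁻²)^{p^a}·β^{m p^a} ≠ 0`.  Whether or not `b` is a `ℤ_p`-power of `x` is decided
INSIDE the rigidity lemma (if not, both series vanish) — so no description of the avatar at `𝔮` and no identity for `φ(𝔮)` is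
needed.  Consequences:

* §1 `exists_unit_map_eq_mul_C_mul_of_isBranchBDPLFunction` — if `c ∈ 𝓞_{ℂ_p}` with `c = ι⁻¹(e)` (the constant is `p`-INTEGRAL,
  e.g. `e = ±1`): `L = U·(c·Q)` in `𝓞_{ℂ_p}⟦T⟧`, `U` a unit; hence `(L) ⊆ (Q)` (`span_map_le_span_of_…`) — the DOOR direction:
  any lower divisibility `I ⊆ (L)` (Keller–Yin's shape) passes to `I ⊆ (Q)`.
* §2 `exists_unit_C_mul_map_eq_mul_of_isBranchBDPLFunction` — if `c' ∈ 𝓞_{ℂ_p}` with `c'·ι⁻¹(e) = 1` (the constant is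
  `p`-CO-INTEGRAL): `c'·L = U·Q`; hence `(Q) ⊆ (L)` — the WING direction: any upper co-divisibility `(L) ⊆ I` passes to `(Q) ⊆ I`.
* §3 for a SIGN `e = ±1` both hold: `(L) = (Q)` (`span_map_eq_span_of_…_of_sign`).

HONEST FRAMING: THEOREMS ONLY (no definition, no named fact, no `sorry`); pure `p`-adic analysis on the tree's predicates plus the
landed twist identity; hypotheses displayed; nothing asserted about any curve; Keller–Yin (where these lemmas are consumed) is a
PREPRINT; BSD is proved for no curve; «closes rung: none».
References: [Castella2018] Thm. 3.1 (arXiv:1704.06608 p. 9); [CastellaHsieh2018] §3.3, Def. 3.5, Prop. 3.6 (arXiv:1505.08165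
pp. 10–11); [Washington1997] §5.1 (`(1+T)^x`) and §7.1; [Gross2004] §3 (the twist identity); [Hsieh2014] Thm. A (the ♭-receptacle).
-/

set_option autoImplicit false

noncomputable section

open scoped Classical Topology NumberField
open Filter NumberField IsDedekindDomain Field PowerSeries CongruenceSubgroup
  Literature.NumberTheory.EllipticCurves Literature.NumberTheory.GaloisRepresentations
  Literature.NumberTheory.EllipticCurves.ModularForms Literature.NumberTheory.EllipticCurves.KellerYin2024
  Summit.BirchSwinnertonDyer.Rank1Residual Summit.BirchSwinnertonDyer.Rank1Residual.X11b
  Summit.BirchSwinnertonDyer.Rank1Residual.X11b.Halves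
  Summit.BirchSwinnertonDyer.Rank1Residual.X11b.Three.LambdaSupply
  Summit.BirchSwinnertonDyer.Rank1Residual.X11b.LambdaSupply
  Summit.BirchSwinnertonDyer.Rank1Residual.X11b.Three.LambdaSupply.PadicUnits

-- `Summit.<P>.<Sub>` repeats `BirchSwinnertonDyer` by the tree's layout convention (D-0017)
set_option linter.dupNamespace false

namespace Summit.BirchSwinnertonDyer.BirchSwinnertonDyer.Theorems.SchneiderFreeAdditiveX3.LZZMatch

variable {K : Type} [Field K] [NumberField K] [IsGalois ℚ K] {p : ℕ} [Fact p.Prime]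

/-! ### §0 Small bookkeeping lemmas -/

omit [IsGalois ℚ K] in
/-- `φ^j(ϖ_v) = φ(ϖ_v)^j` (values at a uniformizer are multiplicative). [cite: TateThesis1967, §2.5 (context)] -/
theorem valueAtUniformizer_pow (φ : HeckeCharacter K) (v : HeightOneSpectrum (𝓞 K)) (j : ℕ) :
    (φ ^ j).valueAtUniformizer v = φ.valueAtUniformizer v ^ j := by
  induction j with
  | zero => rw [pow_zero, pow_zero, valueAtUniformizer_one']
  | succ j ih => rw [pow_succ, pow_succ, HeckeCharacter.valueAtUniformizer_mul', ih]

/-- **The branch value is the multiplier `e·φ(𝔮)⁻²` times Castella's value for `f = f̃ ⊗ ε`** (p635091's `key`, isolated):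
twist identity `L(f̃/K, χ_ε φ, 1) = L(f/K, φ, 1)` and Euler-type factor `1` (`a_p(f) = 0`, `p ∣ N`).
[cite: CastellaHsieh2018, §3.3 (e_𝔭 for p ∣ c)] [cite: Castella2018, Thm. 3.1 (arXiv:1704.06608 p. 9)] [cite: Gross2004, §3 (p. 40)] -/
theorem bdpBranchInterpolationValue_eq_mul_bdpInterpolationValue (hp2 : p ≠ 2)
    (hKp : Algebra.IsUnramifiedIn (𝓞 K) (Ideal.span {(p : ℤ)}))
    {N N' : ℕ} (f : CuspForm (Gamma0 N) 2) (f' : CuspForm (Gamma0 N') 2)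
    (hcoef : ∀ ℓ : ℕ, ℓ.Prime → ℓ ≠ p → cuspCoeff f ℓ = ((legendreSym p ℓ : ℤ) : ℂ) * cuspCoeff f' ℓ)
    (hap : cuspCoeff f p = 0) (hpN : p ∣ N) (hlev : ∀ ℓ : ℕ, ℓ.Prime → ℓ ≠ p → (ℓ ∣ N ↔ ℓ ∣ N'))
    (𝔮 : HeightOneSpectrum (𝓞 K)) (e : ℂ) {φ : HeckeCharacter K}
    (hunr : ∀ v : HeightOneSpectrum (𝓞 K), φ.IsUnramifiedAt v) (n : ℕ) (ΩK : ℂ) :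
    bdpBranchInterpolationValue f' 𝔮 (genusHeckeCharacter K p) e φ n ΩK =
      (e * (heckeValueExtZero φ 𝔮 ^ 2)⁻¹) * bdpInterpolationValue p f 𝔮 φ n ΩK := by
  rw [bdpBranchInterpolationValue, bdpInterpolationValue_of_dvd hpN, hap,
    rankinSelbergValueHecke_genusTwist_eq K hp2 hKp f f' hcoef hap hpN hlev hunr 1]
  ring

/-! ### §1 The test sequence: along `φ₀^{p^a j}` the branch frame and the ♭-frame differ by `ι⁻¹(e)·b^j` -/

/-- **The values of a branch frame of `(f̃, χ_ε, e)` and of a ♭-frame of `f` along the powers of the interpolation character.**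
At an odd `p`, over an imaginary quadratic `K` unramified at `p`, for an anticyclotomic `κ` with topological generator `γ`: there
are a principal unit `x ≠ 1` with `‖x − 1‖ < p⁻¹`, a `b ≠ 0`, and the values `V_j = Q(x^j − 1)`, `V′_j = L(x^j − 1)` with
`V′_j = ι⁻¹(e)·b^j·V_j` for `j ≥ 1`.  (`x = φ̂₀(γ)^{p^a}`, `b = ι⁻¹(φ₀(𝔮)⁻²)^{p^a}·β^{m p^a}` for the interpolation character `φ₀` of
type `(m, −m)`; uses (M1) and `frameValue_rescale`.)  Nothing asserted about any curve.
[cite: Castella2018, Thm. 3.1 (arXiv:1704.06608 p. 9)] [cite: CastellaHsieh2018, Def. 3.5 and Prop. 3.6] -/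
theorem exists_testValues_of_isBranchBDPLFunction_of_isBDPLFunctionInt (hp2 : p ≠ 2) (hK : IsImaginaryQuadratic K)
    (hKp : Algebra.IsUnramifiedIn (𝓞 K) (Ideal.span {(p : ℤ)}))
    {N N' : ℕ} (f : CuspForm (Gamma0 N) 2) (f' : CuspForm (Gamma0 N') 2)
    (hcoef : ∀ ℓ : ℕ, ℓ.Prime → ℓ ≠ p → cuspCoeff f ℓ = ((legendreSym p ℓ : ℤ) : ℂ) * cuspCoeff f' ℓ)
    (hap : cuspCoeff f p = 0) (hpN : p ∣ N) (hlev : ∀ ℓ : ℕ, ℓ.Prime → ℓ ≠ p → (ℓ ∣ N ↔ ℓ ∣ N'))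
    {ι : PadicAlgCl p ≃+* ℂ} {𝔮 : HeightOneSpectrum (𝓞 K)} {κ : ZpExtension K p} {γ : Field.absoluteGaloisGroup K}
    (hκ : κ.IsAnticyclotomic) (hγ : κ.IsTopGenerator γ)
    {e ΩK ΩK' : ℂ} {Ωp Ωp' : ℂ_[p]} {L : UnrSeries p} {Q : PowerSeries 𝓞_ℂ_[p]}
    (hΩK : ΩK ≠ 0) (hΩK' : ΩK' ≠ 0) (hΩp : Ωp ≠ 0) (hΩp' : Ωp' ≠ 0)
    (hL : IsBranchBDPLFunction ι 𝔮 κ γ f' (genusHeckeCharacter K p) e ΩK Ωp L)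
    (hQ : R1.IsBDPLFunctionInt p ι 𝔮 κ γ f ΩK' Ωp' Q) :
    ∃ (x b : ℂ_[p]) (V V' : ℕ → ℂ_[p]), ‖x - 1‖ < (p : ℝ)⁻¹ ∧ x ≠ 1 ∧ b ≠ 0 ∧
      (∀ j, IntSeries.HasValueAt Q (x ^ j - 1) (V j)) ∧
      (∀ j, IntSeries.HasValueAt (PowerSeries.map (R1.unrToCpInt p) L) (x ^ j - 1) (V' j)) ∧
      ∀ j, 0 < j → V' j = ((ι.symm e : PadicAlgCl p) : ℂ_[p]) * b ^ j * V j := by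
  have hp : p.Prime := Fact.out
  -- the interpolation character and its value at `γ`
  obtain ⟨φ₀, m, ψ, hm, hunr, hinf, hav, hfac, hx1, hne⟩ :=
    exists_interpolationCharacter hp2 ι K κ hK hκ γ hγ
  set eU := (FramedRep.unitsContinuousMulEquivOfUnique (Fin 1) (PadicAlgCl p) :
    (PadicAlgCl p)ˣ →ₜ* GL (Fin 1) (PadicAlgCl p)) with heU
  set x₀ : ℂ_[p] := avatarValueAt (eU.comp ψ) γ with hx₀
  have hunr' : ∀ v : HeightOneSpectrum (𝓞 K), ((p : ℕ) : 𝓞 K) ∉ v.asIdeal → φ₀.IsUnramifiedAt v :=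
    fun v _ => hunr v
  -- `a` with `‖x₀^{p^a} − 1‖ < p⁻¹`
  have hpinv : 0 < (p : ℝ)⁻¹ := inv_pos.mpr (by exact_mod_cast hp.pos)
  obtain ⟨a, ha⟩ : ∃ a : ℕ, ‖x₀ ^ p ^ a - 1‖ < (p : ℝ)⁻¹ := by
    have h := tendsto_pow_prime_pow_padicComplex (p := p) hx1
    have hev := h.eventually (Metric.ball_mem_nhds (1 : ℂ_[p]) hpinv)
    obtain ⟨a, ha⟩ := hev.exists
    exact ⟨a, by rwa [dist_eq_norm] at ha⟩
  set x : ℂ_[p] := x₀ ^ p ^ a with hxdef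
  have hxne : x ≠ 1 := hne a
  have hxlt : ‖x - 1‖ < 1 := ha.trans (inv_lt_one_of_one_lt₀ (by exact_mod_cast hp.one_lt))
  -- generic values at the points `x^j − 1`
  have hpt : ∀ j : ℕ, ‖x ^ j - 1‖ < 1 := fun j => (R1.norm_pow_sub_one_le hxlt j).trans_lt hxlt
  choose V hV using fun j : ℕ => intSeries_exists_hasValueAt Q (hpt j)
  choose V' hV' using fun j : ℕ => intSeries_exists_hasValueAt (PowerSeries.map (R1.unrToCpInt p) L) (hpt j)
  -- the period ratio (from `(Ω_K′, Ω_p′)` to `(Ω_K, Ω_p)`) and the multiplier base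
  set β : ℂ_[p] := ((ι.symm ((ΩK' / ΩK) ^ 4) : PadicAlgCl p) : ℂ_[p]) * (Ωp / Ωp') ^ 4 with hβ
  have hβ0 : β ≠ 0 := by
    refine mul_ne_zero ?_ (pow_ne_zero _ (div_ne_zero hΩp hΩp'))
    rw [PadicComplex.coe_eq]
    exact (map_ne_zero_iff _ (algebraMap (PadicAlgCl p) ℂ_[p]).injective).mpr
      ((map_ne_zero_iff _ ι.symm.injective).mpr (pow_ne_zero _ (div_ne_zero hΩK' hΩK)))
  set w₀ : ℂ := φ₀.valueAtUniformizer 𝔮 with hw₀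
  have hw₀0 : w₀ ≠ 0 := HeckeCharacter.valueAtUniformizer_ne_zero' φ₀ 𝔮
  set W : ℂ_[p] := ((ι.symm ((w₀ ^ 2)⁻¹) : PadicAlgCl p) : ℂ_[p]) with hW
  have hW0 : W ≠ 0 := by
    rw [hW, PadicComplex.coe_eq]
    exact (map_ne_zero_iff _ (algebraMap (PadicAlgCl p) ℂ_[p]).injective).mpr
      ((map_ne_zero_iff _ ι.symm.injective).mpr (inv_ne_zero (pow_ne_zero _ hw₀0)))
  set b : ℂ_[p] := W ^ p ^ a * β ^ (m * p ^ a) with hbdef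
  have hb : b ≠ 0 := mul_ne_zero (pow_ne_zero _ hW0) (pow_ne_zero _ hβ0)
  set A : ℂ_[p] := ((ι.symm e : PadicAlgCl p) : ℂ_[p]) with hA
  refine ⟨x, b, V, V', ha, hxne, hb, hV, hV', fun j hj => ?_⟩
  -- the relation at `φ₀^{p^a j}`
  set n : ℕ := p ^ a * j with hn
  have hn0 : 0 < m * n := Nat.mul_pos hm (Nat.mul_pos (pow_pos hp.pos a) hj)
  have hunrn : ∀ v : HeightOneSpectrum (𝓞 K), (φ₀ ^ n).IsUnramifiedAt v :=
    fun v => isUnramifiedAt_pow' (hunr v) n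
  have hinfn : (φ₀ ^ n).HasInfinityType (fun _ ↦ ((m * n : ℕ) : ℤ)) (fun _ ↦ -((m * n : ℕ) : ℤ)) := by
    have h := HasInfinityType.pow_nat hinf n
    convert h using 2 <;> push_cast <;> ring
  have havn : IsPAdicAvatarOf ι (φ₀ ^ n) (eU.comp (ψ ^ n)) := isPAdicAvatarOf_pow ι hav hunr' n
  have hfacn : FactorsThroughZp κ (eU.comp (ψ ^ n)) := factorsThroughZp_unitsChar_pow κ hfac n
  have hvaln : avatarValueAt (eU.comp (ψ ^ n)) γ = x ^ j := by
    rw [heU, avatarValueAt_unitsChar_pow, ← heU, ← hx₀, hxdef, ← pow_mul, hn]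
  -- the two values at `x^j − 1`
  have h1 := hQ (φ₀ ^ n) (m * n) hn0 hunrn hinfn (eU.comp (ψ ^ n)) havn hfacn
  have h2 := (R1.intSeries_hasValueAt_map_iff p L _ _).mpr (hL (φ₀ ^ n) (m * n) hn0 hunrn hinfn (eU.comp (ψ ^ n)) havn hfacn)
  rw [hvaln] at h1 h2
  have e1 : V j = _ := (hV j).unique h1
  have e2 : V' j = _ := (hV' j).unique h2
  -- the branch value in terms of Castella's value for `f` at the periods `(Ω_K, Ω_p)`, then rescaled to `(Ω_K′, Ω_p′)`
  have hhv : heckeValueExtZero (φ₀ ^ n) 𝔮 = w₀ ^ n := by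
    rw [heckeValueExtZero_of_isUnramifiedAt (hunrn 𝔮), valueAtUniformizer_pow]
  have key := bdpBranchInterpolationValue_eq_mul_bdpInterpolationValue hp2 hKp f f' hcoef hap hpN hlev 𝔮 e hunrn
    (m * n) ΩK
  rw [hhv] at key
  -- period rescaling `(Ω_K, Ω_p) → (Ω_K′, Ω_p′)`: the factor `β^{mn}`
  have hresc : (((ι.symm (bdpInterpolationValue p f 𝔮 (φ₀ ^ n) (m * n) ΩK)) : PadicAlgCl p) : ℂ_[p]) *
        Ωp ^ (4 * (m * n)) =
      (((ι.symm (bdpInterpolationValue p f 𝔮 (φ₀ ^ n) (m * n) ΩK')) : PadicAlgCl p) : ℂ_[p]) *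
        Ωp' ^ (4 * (m * n)) * β ^ (m * n) := by
    rw [hβ]
    exact frameValue_rescale ι f 𝔮 (φ₀ ^ n) (m * n) hΩK' hΩK Ωp hΩp'
  -- `ι⁻¹` of the multiplier
  have hmult : (((ι.symm (e * ((w₀ ^ n) ^ 2)⁻¹)) : PadicAlgCl p) : ℂ_[p]) = A * W ^ n := by
    rw [hA, hW, PadicComplex.coe_eq, PadicComplex.coe_eq, PadicComplex.coe_eq, ← map_pow, ← map_pow, ← map_mul,
      ← map_mul, inv_pow, ← pow_mul, ← pow_mul, mul_comm n 2]
  set G : ℂ_[p] := (((ι.symm (bdpInterpolationValue p f 𝔮 (φ₀ ^ n) (m * n) ΩK')) : PadicAlgCl p) : ℂ_[p]) *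
    Ωp' ^ (4 * (m * n)) with hG
  rw [e2, e1, key, map_mul, UniformSpace.Completion.coe_mul, hmult, mul_assoc, hresc, hbdef, hn]
  ring

/-! ### §2 The DOOR direction: an integral constant — `L = U·(c·Q)`, `(L) ⊆ (Q)` -/

/-- **Branch frame = unit × (integral constant) × ♭-frame.**  With the data of
`exists_testValues_of_isBranchBDPLFunction_of_isBDPLFunctionInt` and a `c ∈ 𝓞_{ℂ_p}` with `c = ι⁻¹(e)` (e.g. `e = ±1`):
`L = U·(C(c)·Q)` in `𝓞_{ℂ_p}⟦T⟧` for a UNIT `U` (x11b3's `R1.exists_unit_mul_eq_of_values` applied to `(C(c)·Q, L)`).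
Nothing asserted about any curve. [cite: Washington1997, §5.1 and §7.1] [cite: Castella2018, Thm. 3.1 (arXiv:1704.06608 p. 9)] -/
theorem exists_unit_map_eq_mul_C_mul_of_isBranchBDPLFunction (hp2 : p ≠ 2) (hK : IsImaginaryQuadratic K)
    (hKp : Algebra.IsUnramifiedIn (𝓞 K) (Ideal.span {(p : ℤ)}))
    {N N' : ℕ} (f : CuspForm (Gamma0 N) 2) (f' : CuspForm (Gamma0 N') 2)
    (hcoef : ∀ ℓ : ℕ, ℓ.Prime → ℓ ≠ p → cuspCoeff f ℓ = ((legendreSym p ℓ : ℤ) : ℂ) * cuspCoeff f' ℓ)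
    (hap : cuspCoeff f p = 0) (hpN : p ∣ N) (hlev : ∀ ℓ : ℕ, ℓ.Prime → ℓ ≠ p → (ℓ ∣ N ↔ ℓ ∣ N'))
    {ι : PadicAlgCl p ≃+* ℂ} {𝔮 : HeightOneSpectrum (𝓞 K)} {κ : ZpExtension K p} {γ : Field.absoluteGaloisGroup K}
    (hκ : κ.IsAnticyclotomic) (hγ : κ.IsTopGenerator γ)
    {e ΩK ΩK' : ℂ} {Ωp Ωp' : ℂ_[p]} {L : UnrSeries p} {Q : PowerSeries 𝓞_ℂ_[p]}
    (hΩK : ΩK ≠ 0) (hΩK' : ΩK' ≠ 0) (hΩp : Ωp ≠ 0) (hΩp' : Ωp' ≠ 0)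
    (hL : IsBranchBDPLFunction ι 𝔮 κ γ f' (genusHeckeCharacter K p) e ΩK Ωp L)
    (hQ : R1.IsBDPLFunctionInt p ι 𝔮 κ γ f ΩK' Ωp' Q)
    {c : 𝓞_ℂ_[p]} (hc : (c : ℂ_[p]) = ((ι.symm e : PadicAlgCl p) : ℂ_[p])) :
    ∃ U : PowerSeries 𝓞_ℂ_[p], IsUnit U ∧ PowerSeries.map (R1.unrToCpInt p) L = U * (PowerSeries.C c * Q) := by
  obtain ⟨x, b, V, V', hx, hxne, hb, hV, hV', hrel⟩ :=
    exists_testValues_of_isBranchBDPLFunction_of_isBDPLFunctionInt hp2 hK hKp f f' hcoef hap hpN hlev hκ hγ hΩK hΩK'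
      hΩp hΩp' hL hQ
  have hVc : ∀ j, IntSeries.HasValueAt (PowerSeries.C c * Q) (x ^ j - 1) ((c : ℂ_[p]) * V j) :=
    fun j => intSeries_hasValueAt_C_mul c (hV j)
  refine R1.exists_unit_mul_eq_of_values hx hxne hb hVc hV' fun j hj => ?_
  rw [hrel j hj, hc]
  ring

/-- **DOOR direction: `(L) ⊆ (Q)` for an integral constant**, hence every LOWER divisibility `I·𝓞_{ℂ_p}⟦T⟧ ⊆ (L)` passes to
the ♭-frame: `I·𝓞_{ℂ_p}⟦T⟧ ⊆ (Q)`. [cite: Castella2018Erratum, Thm. 1.1 (p. 1) (shape; under review)]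
[cite: Castella2018, Thm. 3.1 (arXiv:1704.06608 p. 9)] -/
theorem span_map_le_span_of_isBranchBDPLFunction_of_isBDPLFunctionInt (hp2 : p ≠ 2) (hK : IsImaginaryQuadratic K)
    (hKp : Algebra.IsUnramifiedIn (𝓞 K) (Ideal.span {(p : ℤ)}))
    {N N' : ℕ} (f : CuspForm (Gamma0 N) 2) (f' : CuspForm (Gamma0 N') 2)
    (hcoef : ∀ ℓ : ℕ, ℓ.Prime → ℓ ≠ p → cuspCoeff f ℓ = ((legendreSym p ℓ : ℤ) : ℂ) * cuspCoeff f' ℓ)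
    (hap : cuspCoeff f p = 0) (hpN : p ∣ N) (hlev : ∀ ℓ : ℕ, ℓ.Prime → ℓ ≠ p → (ℓ ∣ N ↔ ℓ ∣ N'))
    {ι : PadicAlgCl p ≃+* ℂ} {𝔮 : HeightOneSpectrum (𝓞 K)} {κ : ZpExtension K p} {γ : Field.absoluteGaloisGroup K}
    (hκ : κ.IsAnticyclotomic) (hγ : κ.IsTopGenerator γ)
    {e ΩK ΩK' : ℂ} {Ωp Ωp' : ℂ_[p]} {L : UnrSeries p} {Q : PowerSeries 𝓞_ℂ_[p]}
    (hΩK : ΩK ≠ 0) (hΩK' : ΩK' ≠ 0) (hΩp : Ωp ≠ 0) (hΩp' : Ωp' ≠ 0)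
    (hL : IsBranchBDPLFunction ι 𝔮 κ γ f' (genusHeckeCharacter K p) e ΩK Ωp L)
    (hQ : R1.IsBDPLFunctionInt p ι 𝔮 κ γ f ΩK' Ωp' Q)
    {c : 𝓞_ℂ_[p]} (hc : (c : ℂ_[p]) = ((ι.symm e : PadicAlgCl p) : ℂ_[p])) :
    Ideal.span {PowerSeries.map (R1.unrToCpInt p) L} ≤ Ideal.span {Q} := by
  obtain ⟨U, -, hU⟩ := exists_unit_map_eq_mul_C_mul_of_isBranchBDPLFunction hp2 hK hKp f f' hcoef hap hpN hlev hκ hγ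
    hΩK hΩK' hΩp hΩp' hL hQ hc
  rw [Ideal.span_singleton_le_iff_mem, hU, ← mul_assoc]
  exact Ideal.mul_mem_left _ _ (Ideal.mem_span_singleton_self Q)

/-! ### §3 The WING direction: a co-integral constant — `c′·L = U·Q`, `(Q) ⊆ (L)` -/

/-- **(co-integral constant) × branch frame = unit × ♭-frame.**  With `c′ ∈ 𝓞_{ℂ_p}`, `c′·ι⁻¹(e) = 1` (e.g. `e = ±1`):
`C(c′)·L = U·Q` for a UNIT `U` (`R1.exists_unit_mul_eq_of_values` applied to `(Q, C(c′)·L)`).  Nothing asserted about any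
curve. [cite: Washington1997, §5.1 and §7.1] [cite: Castella2018, Thm. 3.1 (arXiv:1704.06608 p. 9)] -/
theorem exists_unit_C_mul_map_eq_mul_of_isBranchBDPLFunction (hp2 : p ≠ 2) (hK : IsImaginaryQuadratic K)
    (hKp : Algebra.IsUnramifiedIn (𝓞 K) (Ideal.span {(p : ℤ)}))
    {N N' : ℕ} (f : CuspForm (Gamma0 N) 2) (f' : CuspForm (Gamma0 N') 2)
    (hcoef : ∀ ℓ : ℕ, ℓ.Prime → ℓ ≠ p → cuspCoeff f ℓ = ((legendreSym p ℓ : ℤ) : ℂ) * cuspCoeff f' ℓ)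
    (hap : cuspCoeff f p = 0) (hpN : p ∣ N) (hlev : ∀ ℓ : ℕ, ℓ.Prime → ℓ ≠ p → (ℓ ∣ N ↔ ℓ ∣ N'))
    {ι : PadicAlgCl p ≃+* ℂ} {𝔮 : HeightOneSpectrum (𝓞 K)} {κ : ZpExtension K p} {γ : Field.absoluteGaloisGroup K}
    (hκ : κ.IsAnticyclotomic) (hγ : κ.IsTopGenerator γ)
    {e ΩK ΩK' : ℂ} {Ωp Ωp' : ℂ_[p]} {L : UnrSeries p} {Q : PowerSeries 𝓞_ℂ_[p]}
    (hΩK : ΩK ≠ 0) (hΩK' : ΩK' ≠ 0) (hΩp : Ωp ≠ 0) (hΩp' : Ωp' ≠ 0)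
    (hL : IsBranchBDPLFunction ι 𝔮 κ γ f' (genusHeckeCharacter K p) e ΩK Ωp L)
    (hQ : R1.IsBDPLFunctionInt p ι 𝔮 κ γ f ΩK' Ωp' Q)
    {c' : 𝓞_ℂ_[p]} (hc' : (c' : ℂ_[p]) * ((ι.symm e : PadicAlgCl p) : ℂ_[p]) = 1) :
    ∃ U : PowerSeries 𝓞_ℂ_[p], IsUnit U ∧ PowerSeries.C c' * PowerSeries.map (R1.unrToCpInt p) L = U * Q := by
  obtain ⟨x, b, V, V', hx, hxne, hb, hV, hV', hrel⟩ :=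
    exists_testValues_of_isBranchBDPLFunction_of_isBDPLFunctionInt hp2 hK hKp f f' hcoef hap hpN hlev hκ hγ hΩK hΩK'
      hΩp hΩp' hL hQ
  have hVc : ∀ j, IntSeries.HasValueAt (PowerSeries.C c' * PowerSeries.map (R1.unrToCpInt p) L) (x ^ j - 1)
      ((c' : ℂ_[p]) * V' j) :=
    fun j => intSeries_hasValueAt_C_mul c' (hV' j)
  refine R1.exists_unit_mul_eq_of_values hx hxne hb hV hVc fun j hj => ?_
  rw [hrel j hj]
  calc (c' : ℂ_[p]) * (((ι.symm e : PadicAlgCl p) : ℂ_[p]) * b ^ j * V j)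
      = ((c' : ℂ_[p]) * ((ι.symm e : PadicAlgCl p) : ℂ_[p])) * (b ^ j * V j) := by ring
    _ = b ^ j * V j := by rw [hc', one_mul]

/-- **WING direction: `(Q) ⊆ (L)` for a co-integral constant**, hence every UPPER co-divisibility `(L) ⊆ I·𝓞_{ℂ_p}⟦T⟧` passes
to the ♭-frame: `(Q) ⊆ I·𝓞_{ℂ_p}⟦T⟧`. [cite: Castella2018Erratum, Thm. 1.1 (p. 1) (shape; under review)]
[cite: Castella2018, Thm. 3.1 (arXiv:1704.06608 p. 9)] -/
theorem span_le_span_map_of_isBranchBDPLFunction_of_isBDPLFunctionInt (hp2 : p ≠ 2) (hK : IsImaginaryQuadratic K)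
    (hKp : Algebra.IsUnramifiedIn (𝓞 K) (Ideal.span {(p : ℤ)}))
    {N N' : ℕ} (f : CuspForm (Gamma0 N) 2) (f' : CuspForm (Gamma0 N') 2)
    (hcoef : ∀ ℓ : ℕ, ℓ.Prime → ℓ ≠ p → cuspCoeff f ℓ = ((legendreSym p ℓ : ℤ) : ℂ) * cuspCoeff f' ℓ)
    (hap : cuspCoeff f p = 0) (hpN : p ∣ N) (hlev : ∀ ℓ : ℕ, ℓ.Prime → ℓ ≠ p → (ℓ ∣ N ↔ ℓ ∣ N'))
    {ι : PadicAlgCl p ≃+* ℂ} {𝔮 : HeightOneSpectrum (𝓞 K)} {κ : ZpExtension K p} {γ : Field.absoluteGaloisGroup K}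
    (hκ : κ.IsAnticyclotomic) (hγ : κ.IsTopGenerator γ)
    {e ΩK ΩK' : ℂ} {Ωp Ωp' : ℂ_[p]} {L : UnrSeries p} {Q : PowerSeries 𝓞_ℂ_[p]}
    (hΩK : ΩK ≠ 0) (hΩK' : ΩK' ≠ 0) (hΩp : Ωp ≠ 0) (hΩp' : Ωp' ≠ 0)
    (hL : IsBranchBDPLFunction ι 𝔮 κ γ f' (genusHeckeCharacter K p) e ΩK Ωp L)
    (hQ : R1.IsBDPLFunctionInt p ι 𝔮 κ γ f ΩK' Ωp' Q)
    {c' : 𝓞_ℂ_[p]} (hc' : (c' : ℂ_[p]) * ((ι.symm e : PadicAlgCl p) : ℂ_[p]) = 1) :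
    Ideal.span {Q} ≤ Ideal.span {PowerSeries.map (R1.unrToCpInt p) L} := by
  obtain ⟨U, hUu, hU⟩ := exists_unit_C_mul_map_eq_mul_of_isBranchBDPLFunction hp2 hK hKp f f' hcoef hap hpN hlev hκ hγ
    hΩK hΩK' hΩp hΩp' hL hQ hc'
  rw [Ideal.span_singleton_le_iff_mem]
  have hQ' : Q = ↑hUu.unit⁻¹ * (PowerSeries.C c' * PowerSeries.map (R1.unrToCpInt p) L) := by
    rw [hU, ← mul_assoc, IsUnit.val_inv_mul, one_mul]
  rw [hQ', ← mul_assoc]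
  exact Ideal.mul_mem_left _ _ (Ideal.mem_span_singleton_self _)

/-! ### §4 A SIGN `e = ±1`: both directions, `(L) = (Q)` -/

/-- For a sign `e ∈ {1, −1}` the constant `ι⁻¹(e) = ±1` is integral AND co-integral: witnesses in `𝓞_{ℂ_p}`.
[cite: CastellaHsieh2018, §3.3 (e_𝔭 = ε(½, χ_𝔭)⁻² for p ∣ c; a sign for quadratic χ_𝔭)] -/
theorem exists_coe_eq_symm_of_sign {ι : PadicAlgCl p ≃+* ℂ} {e : ℂ} (he : e = 1 ∨ e = -1) :
    ∃ c : 𝓞_ℂ_[p], (c : ℂ_[p]) = ((ι.symm e : PadicAlgCl p) : ℂ_[p]) ∧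
      (c : ℂ_[p]) * ((ι.symm e : PadicAlgCl p) : ℂ_[p]) = 1 := by
  rcases he with rfl | rfl
  · refine ⟨1, ?_, ?_⟩ <;> simp [PadicComplex.coe_eq]
  · refine ⟨-1, ?_, ?_⟩ <;> simp [PadicComplex.coe_eq]

/-- **For a branch SIGN `e = ±1` the branch frame and the ♭-frame generate the SAME ideal of `𝓞_{ℂ_p}⟦T⟧`.**
[cite: Castella2018, Thm. 3.1 (arXiv:1704.06608 p. 9)] [cite: CastellaHsieh2018, §3.3, Def. 3.5 and Prop. 3.6] -/
theorem span_map_eq_span_of_isBranchBDPLFunction_of_sign (hp2 : p ≠ 2) (hK : IsImaginaryQuadratic K)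
    (hKp : Algebra.IsUnramifiedIn (𝓞 K) (Ideal.span {(p : ℤ)}))
    {N N' : ℕ} (f : CuspForm (Gamma0 N) 2) (f' : CuspForm (Gamma0 N') 2)
    (hcoef : ∀ ℓ : ℕ, ℓ.Prime → ℓ ≠ p → cuspCoeff f ℓ = ((legendreSym p ℓ : ℤ) : ℂ) * cuspCoeff f' ℓ)
    (hap : cuspCoeff f p = 0) (hpN : p ∣ N) (hlev : ∀ ℓ : ℕ, ℓ.Prime → ℓ ≠ p → (ℓ ∣ N ↔ ℓ ∣ N'))
    {ι : PadicAlgCl p ≃+* ℂ} {𝔮 : HeightOneSpectrum (𝓞 K)} {κ : ZpExtension K p} {γ : Field.absoluteGaloisGroup K}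
    (hκ : κ.IsAnticyclotomic) (hγ : κ.IsTopGenerator γ)
    {e ΩK ΩK' : ℂ} {Ωp Ωp' : ℂ_[p]} {L : UnrSeries p} {Q : PowerSeries 𝓞_ℂ_[p]}
    (he : e = 1 ∨ e = -1) (hΩK : ΩK ≠ 0) (hΩK' : ΩK' ≠ 0) (hΩp : Ωp ≠ 0) (hΩp' : Ωp' ≠ 0)
    (hL : IsBranchBDPLFunction ι 𝔮 κ γ f' (genusHeckeCharacter K p) e ΩK Ωp L)
    (hQ : R1.IsBDPLFunctionInt p ι 𝔮 κ γ f ΩK' Ωp' Q) :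
    Ideal.span {PowerSeries.map (R1.unrToCpInt p) L} = Ideal.span {Q} := by
  obtain ⟨c, hc, hc'⟩ := exists_coe_eq_symm_of_sign (ι := ι) he
  exact le_antisymm
    (span_map_le_span_of_isBranchBDPLFunction_of_isBDPLFunctionInt hp2 hK hKp f f' hcoef hap hpN hlev hκ hγ hΩK hΩK' hΩp
      hΩp' hL hQ hc)
    (span_le_span_map_of_isBranchBDPLFunction_of_isBDPLFunctionInt hp2 hK hKp f f' hcoef hap hpN hlev hκ hγ hΩK hΩK' hΩp
      hΩp' hL hQ hc')

end Summit.BirchSwinnertonDyer.BirchSwinnertonDyer.Theorems.SchneiderFreeAdditiveX3.LZZMatch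

end
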